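import Literature.Algebra.Lie.LefschetzTripleRepresentation
import Mathlib.LinearAlgebra.Matrix.Adjugate
import Mathlib.LinearAlgebra.Matrix.ToLin
import Mathlib.LinearAlgebra.Determinant
import Mathlib.LinearAlgebra.Projection
import Mathlib.LinearAlgebra.Dual.Lemmas
import Mathlib.Algebra.Polynomial.Roots
import HarnessLib

/-!
# Generic generation: `𝔞` and the partners `f_a` of a line-open set of Lefschetz elements generate `𝔤(𝔞, ·)` (Looijenga–Lunts 1997, §1 (1.1))

Topic `Literature/Algebra/Lie` (namespace `Literature.Algebra.Lie`).  Lane `lit-hodgefound` (Track 2 foundations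
library), skeleton seat `lit-hodgefound-skel-1` (generation 45), row **A1-139** of
`run/shared/lean/pub/lit-hodgefound/SKELETON.md`.  Sequel of `LefschetzTriple.lean` (A1-84: `adDegree`,
`lefschetzDomain` = the domain of `f`, `lefschetzDuals` = the image of `f`, `IsLefschetzTriple`), `LefschetzModule.lean`
(A1-88: `lefschetzLieAlgebra K h 𝔞 = 𝔤(𝔞, ·)`, the Lie subalgebra generated by `𝔞` and the image of `f`),
`LefschetzDomainSpan.lean` (A1-111: the Lefschetz locus is Zariski open ALONG LINES — all but finitely many points of a
line through a Lefschetz point are Lefschetz) and `LefschetzTripleRepresentation.lean` (A1-106: the Lefschetz property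
of `ad e` for an `𝔰𝔩₂`-triple `(e, h, f)`).  PROVED theorems only: no definition, no named fact, no instance, no
`sorry` (D-0026 net debt `0`).

## Source, VERBATIM

E. Looijenga, V. A. Lunts, *A Lie algebra attached to a projective variety*, Invent. Math. **129** (1997) 361–412,
§1 (1.1) (held TeX text `paper:arxiv-alg-geom_9604014`, p0004 L31–L37) and §1 p0007 L66:

> "Notice that the set of `a ∈ 𝔞` with the Lefschetz property is always Zariski open in `𝔞`. For `a` in this open
> set, we have defined the operator `f_a` such that `(e_a, h, f_a)` is `𝔰𝔩(2)`-triple. This defines a rational map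
> `f : 𝔞 → 𝔤𝔩(M)` in the sense of algebraic geometry. We let `𝔤(𝔞, M)` denote the Lie subalgebra of `𝔤𝔩(M)`
> generated by the transformations `e_a, f_a`."
> "(ii) `𝔤` is as a Lie algebra generated by `𝔞` and the image of `f`."

## Statement and purpose

The paper freely replaces "the image of `f`" by the image of a GENERIC subset of the domain of `f` (a non-empty
Zariski-open subset is dense, and `f` is a rational map, so the linear span of `f(U)` — indeed the Lie subalgebra
generated together with `𝔞` — does not change).  This file proves that consequence in the lane's line-wise rendering
of "Zariski open" (A1-111): for a finite-dimensional Lie algebra `L` over a field `K` of characteristic `0`, `h ∈ L`, a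
subspace `𝔞 ≤ L` and a non-empty subset `U ⊆ dom f` which is LINE-OPEN in `𝔞` (for `a ∈ U` and `b ∈ 𝔞`, `a + t b ∈ U`
for all but finitely many `t ∈ K`),

  `lieSpan (𝔞 ∪ {f_a | a ∈ U}) = lieSpan (𝔞 ∪ f(dom f)) = 𝔤(𝔞, ·)`

(**`lieSpan_union_duals_eq_lefschetzLieAlgebra_of_lineOpen`**); for a Lefschetz triple this is `= 𝔤`
(`IsLefschetzTriple.lieSpan_union_duals_eq_top_of_lineOpen`); and, sharper, with LINEAR spans only,

  `f(dom f) ⊆ span f(U)`, `span f(U) = span f(dom f)`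

(**`mem_submodule_of_forall_duals_mem_of_lineOpen`**, `lefschetzDuals_subset_span_duals_of_lineOpen`,
`span_duals_eq_span_lefschetzDuals_of_lineOpen` — rider, generation 45: the argument works for any subspace containing
`f(U)`).  It is the algebraic heart of the closure of Lefschetz
modules OF ONE `𝔞` under direct sums and tensor products (p0004 L62–L63; row A1-140): there only the `a ∈ 𝔞` that are
Lefschetz on both modules — a line-open set — have partners of the form `f'_a ⊕ f''_a`.

## Proof (the source gives none; standard)

Let `b ∈ dom f` with partner `f_b`, pick `a ∈ U` and put `c_t = a + t (b - a)` (so `c_1 = b` and `c_t ∈ U` for all but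
finitely many `t`).  For every `c ∈ dom f`, `(ad c)² : 𝔤₋₂ → 𝔤₂` is a bijection (the Lefschetz property of `ad c` on
`(𝔤, ad h)`, `hasLefschetzProperty_toEnd_of_isSl2Triple` with `M = 𝔤`; §1) and `(ad c)² f_c = [c, h] = -2c`.  In bases of
`𝔤₋₂`, `𝔤₂` the matrix of `(ad c_t)²` is quadratic in `t`, so by the adjugate identity `adj(A) A = det(A) 1`
(`Matrix.adjugate_mul`) the vector `det((ad c_t)²) · [f_{c_t}] = adj((ad c_t)²) · [-2 c_t]` is a POLYNOMIAL function of
`t` (Mathlib: matrices over `K[X]`, `RingHom.map_adjugate`, `RingHom.map_det`, evaluation).  A linear functional on `𝔤₋₂`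
that kills `𝔤₋₂ ∩ lieSpan(𝔞 ∪ f(U))` kills this vector at the infinitely many `t` with `c_t ∈ U`, hence identically
(`Polynomial.eq_zero_of_infinite_isRoot`), hence at `t = 1`, where `det ≠ 0`: so `f_b ∈ lieSpan(𝔞 ∪ f(U))`
(`Submodule.exists_dual_map_eq_bot_of_notMem`).

## SCOPE (what is NOT formalised here)

(a) No Zariski topology: "open" is the line-wise finiteness hypothesis `hline`, exactly as in A1-111 (which proves it
for the whole Lefschetz locus of a module).  (b) Generation by `𝔞` and a SINGLE partner `f_a` is not claimed (a point is
not line-open).  (c) Nothing here concerns complex tori or the Hodge conjecture.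

## References

* [LooijengaLunts1997] E. Looijenga, V. A. Lunts, *A Lie algebra attached to a projective variety*, Invent. Math. 129
  (1997) 361–412; arXiv:alg-geom/9604014. §1 (1.1) p. 4 L31–L37, L62–L63; §1 p. 7 L66 (held
  `paper:arxiv-alg-geom_9604014`).
-/

namespace Literature.Algebra.Lie

open Module Function Set Polynomial LieModule
open scoped Matrix

/-! ### §1 `(ad e)² : 𝔤₋₂ ≅ 𝔤₂` and `(ad e)² f = -2e` for an `𝔰𝔩₂`-triple `(e, h, f)` -/

section AdSquare

variable {K : Type*} [Field K] [CharZero K] {L : Type*} [LieRing L] [LieAlgebra K L] {h : L}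

/-- For an `𝔰𝔩₂`-triple `(e, h, f)` of `𝔤` (characteristic `0`), `ad h ≠ 0` (it doubles `e ≠ 0`).
[cite: LooijengaLunts1997, §1 (1.1) p0004 L1–L5 ("(e,h,f) is a 𝔰𝔩(2)-triple … defines a representation of 𝔰𝔩(2)")] -/
theorem toEnd_h_ne_zero_of_isSl2Triple {e f : L} (t : IsSl2Triple h e f) : toEnd K L L h ≠ 0 := by
  intro h0
  have h1 : ⁅h, e⁆ = 0 := by rw [← LieModule.toEnd_apply_apply K L L h e, h0, LinearMap.zero_apply]
  have h2 : (2 : K) • e = 0 := by rw [← t.lie_h_e_smul K, h1]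
  exact t.e_ne_zero ((smul_eq_zero.1 h2).resolve_left two_ne_zero)

/-- **`(ad e)²` maps `𝔤₋₂` bijectively onto `𝔤₂`** for an `𝔰𝔩₂`-triple `(e, h, f)` of a finite-dimensional `𝔤`: the
case `k = 2` of the Lefschetz property of `ad e` on `(𝔤, ad h)` (A1-106 `hasLefschetzProperty_toEnd_of_isSl2Triple`
for the adjoint module). [cite: LooijengaLunts1997, §1 (1.1) p0004 L1–L2 ("eᵏ maps M₋ₖ isomorphically onto Mₖ"), p0007 L61–L64 (condition (i))] -/
theorem bijOn_ad_mul_ad_of_isSl2Triple [FiniteDimensional K L] {e f : L} (t : IsSl2Triple h e f) :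
    BijOn ⇑(LieAlgebra.ad K L e * LieAlgebra.ad K L e) (adDegree K h (-2)) (adDegree K h 2) := by
  have L1 := hasLefschetzProperty_toEnd_of_isSl2Triple (K := K) (M := L) t (toEnd_h_ne_zero_of_isSl2Triple t)
  have h2 := L1.bijOn 2
  rw [pow_two] at h2
  have e1 : degreeSpace (toEnd K L L h) (-((2 : ℕ) : ℤ)) = adDegree K h (-2) := by
    rw [show toEnd K L L h = LieAlgebra.ad K L h from rfl, ← adDegree_intCast_eq_degreeSpace]
    norm_num
  have e2 : degreeSpace (toEnd K L L h) ((2 : ℕ) : ℤ) = adDegree K h 2 := by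
    rw [show toEnd K L L h = LieAlgebra.ad K L h from rfl, ← adDegree_intCast_eq_degreeSpace]
    norm_num
  rw [e1, e2] at h2
  exact h2

omit [CharZero K] in
/-- `(ad e)² f = [e, [e, f]] = [e, h] = -2e` for an `𝔰𝔩₂`-triple `(e, h, f)`. [cite: LooijengaLunts1997, §1 (1.1) p0004 L3–L5] -/
theorem lie_lie_f_of_isSl2Triple {e f : L} (t : IsSl2Triple h e f) : ⁅e, ⁅e, f⁆⁆ = (-2 : K) • e := by
  rw [t.lie_e_f, ← lie_skew, t.lie_h_e_smul K, neg_smul]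

omit [CharZero K] in
/-- An element of degree `2` maps `𝔤₋₂` into `𝔤₂` by `(ad x)²`. [cite: LooijengaLunts1997, §1 (1.1) p0003 L106–L111 ("[h,u] = ku"), p0004 L56–L57] -/
theorem ad_mul_ad_mapsTo {x : L} (hx : x ∈ adDegree K h 2) :
    MapsTo ⇑(LieAlgebra.ad K L x * LieAlgebra.ad K L x) (adDegree K h (-2)) (adDegree K h 2) := by
  intro y hy
  rw [SetLike.mem_coe] at hy ⊢
  have h1 := lie_mem_adDegree hx (lie_mem_adDegree hx hy)
  rw [show (2 : K) + (2 + -2) = 2 by ring] at h1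
  simpa [Module.End.mul_apply, LieAlgebra.ad_apply] using h1

end AdSquare

/-! ### §2 Generic generation -/

section Generic

variable {K : Type*} [Field K] [CharZero K] {L : Type*} [LieRing L] [LieAlgebra K L] [FiniteDimensional K L]
  {h : L} {𝔞 : Submodule K L} {U : Set L}

/-- **The partner `f_b` of EVERY `b ∈ dom f` lies in any subspace `G` containing the partners of a non-empty line-open
`U ⊆ dom f`** — the rational map `f` restricted to the line `c_t = a + t(b - a)`, `a ∈ U`: the polynomial vector
`det((ad c_t)²)·f_{c_t} = adj((ad c_t)²)(-2c_t)` lies in `G` for the infinitely many `t` with `c_t ∈ U`, hence for `t = 1`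
("the image of a non-empty Zariski-open subset of `dom f` under `f` spans the same space as `f(dom f)`"; used with
`G = span f(U)` and with `G =` a Lie subalgebra below). [cite: LooijengaLunts1997, §1 (1.1) p0004 L31–L37 ("Zariski open … rational map f"), §3 (3.3) proof p0013 L102–L107 ("The nondegenerate 2-forms make up a nonempty open subset … and therefore span that space")] -/
theorem mem_submodule_of_forall_duals_mem_of_lineOpen (hU : U ⊆ lefschetzDomain K h 𝔞) (hne : U.Nonempty)
    (hline : ∀ a ∈ U, ∀ d ∈ 𝔞, {t : K | a + t • d ∉ U}.Finite) {G : Submodule K L}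
    (hG : ∀ e ∈ U, ∀ f : L, IsSl2Triple h e f → f ∈ G) {b fb : L} (hb : b ∈ 𝔞) (tb : IsSl2Triple h b fb) :
    fb ∈ G := by
  classical
  haveI : Infinite K := Infinite.of_injective _ Nat.cast_injective
  obtain ⟨a, haU⟩ := hne
  obtain ⟨ha𝔞, fa, ta⟩ := hU haU
  -- the line `c t = a + t (b - a)` through `a ∈ U` and `b`
  set d : L := b - a with hd
  have hd𝔞 : d ∈ 𝔞 := 𝔞.sub_mem hb ha𝔞
  let c : K → L := fun t ↦ a + t • d
  have hc1 : c 1 = b := by simp [c, hd]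
  -- the degree `±2` parts
  set V : Submodule K L := adDegree K h (-2) with hV
  set W : Submodule K L := adDegree K h 2 with hW
  have haW : a ∈ W := e_mem_adDegree ta
  have hbW : b ∈ W := e_mem_adDegree tb
  have hdW : d ∈ W := W.sub_mem hbW haW
  have hcW : ∀ t : K, c t ∈ W := fun t ↦ W.add_mem haW (W.smul_mem t hdW)
  have hfbV : fb ∈ V := f_mem_adDegree tb
  -- `Q x = (ad x)²`
  let ad : L →ₗ[K] Module.End K L := (LieAlgebra.ad K L : L →ₗ[K] Module.End K L)
  let Q : L → Module.End K L := fun x ↦ ad x * ad x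
  have hQapply : ∀ x y : L, Q x y = ⁅x, ⁅x, y⁆⁆ := fun x y ↦ by
    simp [Q, ad, Module.End.mul_apply, LieAlgebra.ad_apply]
  have hQmaps : ∀ t : K, MapsTo (Q (c t)) V W := fun t ↦ ad_mul_ad_mapsTo (hcW t)
  have hQbij : ∀ {x fx : L}, IsSl2Triple h x fx → BijOn (Q x) V W := fun t ↦ bijOn_ad_mul_ad_of_isSl2Triple t
  -- a projection `π : L → 𝔤₂` and the restriction operator `R g = π ∘ g|_{𝔤₋₂}`
  obtain ⟨W', hcpl⟩ := Submodule.exists_isCompl W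
  let π : L →ₗ[K] W := W.projectionOnto W' hcpl
  have hπ : ∀ {y : L}, y ∈ W → (π y : L) = y := fun hy ↦
    congrArg Subtype.val (Submodule.projectionOnto_apply_of_mem_left hcpl hy)
  let R : Module.End K L → (V →ₗ[K] W) := fun g ↦ π ∘ₗ g ∘ₗ V.subtype
  have hR : ∀ g : Module.End K L, MapsTo g V W → ∀ x : V, (R g x : L) = g x := fun g hg x ↦ by
    show ((π (g x) : W) : L) = g x
    exact hπ (hg x.2)
  have hbij' : ∀ g : Module.End K L, MapsTo g V W → BijOn g V W → Function.Bijective (R g) := by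
    intro g hg hB
    refine ⟨fun x y hxy ↦ Subtype.ext (hB.injOn x.2 y.2 ?_), fun y ↦ ?_⟩
    · rw [← hR g hg x, ← hR g hg y, hxy]
    · obtain ⟨x, hx, hxy⟩ := hB.surjOn y.2
      exact ⟨⟨x, hx⟩, Subtype.ext (by rw [hR g hg]; exact hxy)⟩
  -- bases of `𝔤₋₂` and `𝔤₂` with the same index type (equidimensional through `(ad b)²`)
  have hRb : Function.Bijective (R (Q b)) := hbij' _ (hc1 ▸ hQmaps 1) (hQbij tb)
  have hVW : finrank K V = finrank K W := LinearEquiv.finrank_eq (LinearEquiv.ofBijective (R (Q b)) hRb)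
  set n : ℕ := finrank K V with hn
  let bV : Basis (Fin n) K V := Module.finBasis K V
  let bW : Basis (Fin n) K W := (Module.finBasis K W).reindex (finCongr hVW.symm)
  let Θ : Module.End K L → Matrix (Fin n) (Fin n) K := fun g ↦ LinearMap.toMatrix bV bW (R g)
  -- the quadratic expansion of `(ad c_t)²`
  let G0 : Module.End K L := ad a * ad a
  let G1 : Module.End K L := ad a * ad d + ad d * ad a
  let G2 : Module.End K L := ad d * ad d
  have hQc : ∀ t : K, Q (c t) = G0 + t • G1 + t ^ 2 • G2 := fun t ↦ by
    simp only [Q, c, G0, G1, G2, map_add, map_smul, mul_add, add_mul, smul_mul_assoc, mul_smul_comm, smul_smul,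
      smul_add, pow_two]
    abel
  have hRlin : ∀ t : K, R (G0 + t • G1 + t ^ 2 • G2) = R G0 + t • R G1 + t ^ 2 • R G2 := fun t ↦ by
    apply LinearMap.ext
    intro x
    simp only [R, LinearMap.comp_apply, LinearMap.add_apply, LinearMap.smul_apply, map_add, map_smul]
  have hΘ : ∀ t : K, Θ (Q (c t)) = Θ G0 + t • Θ G1 + t ^ 2 • Θ G2 := fun t ↦ by
    simp only [Θ, hQc t, hRlin t, map_add, map_smul]
  -- the matrix of `(ad c_t)²` as a matrix over `K[X]`
  let ΘX : Matrix (Fin n) (Fin n) K[X] := fun i j ↦ C (Θ G0 i j) + X * C (Θ G1 i j) + X ^ 2 * C (Θ G2 i j)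
  have hΘX : ∀ t : K, ΘX.map (evalRingHom t) = Θ (Q (c t)) := fun t ↦ by
    ext i j
    simp only [ΘX, Matrix.map_apply, coe_evalRingHom, eval_add, eval_mul, eval_C, eval_X, eval_pow, hΘ t,
      Matrix.add_apply, Matrix.smul_apply, smul_eq_mul]
  -- the vector `[-2 c_t]` in the basis of `𝔤₂`, as a vector over `K[X]`
  let vX : Fin n → K[X] := fun i ↦ C (bW.repr (π ((-2 : K) • a)) i) + X * C (bW.repr (π ((-2 : K) • d)) i)
  have hvX : ∀ t : K, (evalRingHom t) ∘ vX = ⇑(bW.repr (π ((-2 : K) • c t))) := fun t ↦ by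
    funext i
    have h1 : (-2 : K) • c t = (-2 : K) • a + t • ((-2 : K) • d) := by
      simp only [c, smul_add, smul_comm (-2 : K) t d]
    simp only [Function.comp_apply, vX, coe_evalRingHom, eval_add, eval_mul, eval_C, eval_X, h1, map_add, map_smul,
      Finsupp.coe_add, Finsupp.coe_smul, Pi.add_apply, Pi.smul_apply, smul_eq_mul]
  -- the polynomial vector `adj · [-2 c_t]`
  let PX : Fin n → K[X] := ΘX.adjugate *ᵥ vX
  -- KEY IDENTITY: at every `t` with `c_t ∈ dom f`, `PX(t) = det((ad c_t)²) · [f_{c_t}]`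
  have hkey : ∀ (t : K) (ft : L) (tt : IsSl2Triple h (c t) ft) (i : Fin n),
      (PX i).eval t = (Θ (Q (c t))).det * bV.repr ⟨ft, f_mem_adDegree tt⟩ i := by
    intro t ft tt i
    have hmv : Θ (Q (c t)) *ᵥ ⇑(bV.repr ⟨ft, f_mem_adDegree tt⟩) = ⇑(bW.repr (π ((-2 : K) • c t))) := by
      rw [LinearMap.toMatrix_mulVec_repr]
      congr 2
      apply Subtype.ext
      rw [hR _ (hQmaps t)]
      show Q (c t) ft = _
      rw [hπ (W.smul_mem _ (hcW t)), hQapply, lie_lie_f_of_isSl2Triple (K := K) tt]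
    have h1 : (PX i).eval t = ((ΘX.map (evalRingHom t)).adjugate *ᵥ ((evalRingHom t) ∘ vX)) i := by
      show (evalRingHom t) ((ΘX.adjugate *ᵥ vX) i) = _
      rw [RingHom.map_mulVec, ← RingHom.mapMatrix_apply, RingHom.map_adjugate, RingHom.mapMatrix_apply]
    rw [h1, hΘX t, hvX t, ← hmv, Matrix.mulVec_mulVec, Matrix.adjugate_mul, Matrix.smul_mulVec, Matrix.one_mulVec,
      Pi.smul_apply, smul_eq_mul]
  -- suppose `f_b ∉ G`; separate it from `G ∩ 𝔤₋₂` by a linear functional on `𝔤₋₂`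
  by_contra hcon
  let WG : Submodule K V := G.comap V.subtype
  have hfbWG : (⟨fb, hfbV⟩ : V) ∉ WG := fun h1 ↦ hcon h1
  obtain ⟨lam, hlamfb, hlamWG⟩ := Submodule.exists_dual_map_eq_bot_of_notMem hfbWG inferInstance
  have hlam0 : ∀ y : V, (y : L) ∈ G → lam y = 0 := fun y hy ↦ by
    have h1 : lam y ∈ WG.map lam := Submodule.mem_map_of_mem hy
    rw [hlamWG, Submodule.mem_bot] at h1
    exact h1
  have hlamsum : ∀ y : V, lam y = ∑ i, bV.repr y i * lam (bV i) := fun y ↦ by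
    conv_lhs => rw [← bV.sum_repr y]
    simp only [map_sum, map_smul, smul_eq_mul]
  -- the polynomial `t ↦ det((ad c_t)²) · λ(f_{c_t})`
  let pX : K[X] := ∑ i, C (lam (bV i)) * PX i
  have hpX : ∀ (t : K) (ft : L) (tt : IsSl2Triple h (c t) ft),
      pX.eval t = (Θ (Q (c t))).det * lam ⟨ft, f_mem_adDegree tt⟩ := by
    intro t ft tt
    simp only [pX, eval_finsetSum, eval_mul, eval_C, hkey t ft tt, hlamsum ⟨ft, f_mem_adDegree tt⟩, Finset.mul_sum]
    refine Finset.sum_congr rfl fun i _ ↦ ?_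
    ring
  -- it vanishes at the infinitely many `t` with `c_t ∈ U` …
  have hroots : {t : K | a + t • d ∉ U}ᶜ ⊆ {t : K | pX.IsRoot t} := by
    intro t ht
    rw [Set.mem_compl_iff, Set.mem_setOf_eq, not_not] at ht
    obtain ⟨-, ft, tt⟩ := hU ht
    have hftG : ft ∈ G := hG (c t) ht ft tt
    rw [Set.mem_setOf_eq, IsRoot.def, hpX t ft tt, hlam0 _ hftG, mul_zero]
  have hpX0 : pX = 0 :=
    pX.eq_zero_of_infinite_isRoot (((hline a haU d hd𝔞).infinite_compl).mono hroots)
  -- … hence at `t = 1`, where `det((ad b)²) ≠ 0`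
  have tb' : IsSl2Triple h (c 1) fb := by rw [hc1]; exact tb
  have h1 := hpX 1 fb tb'
  rw [hpX0, eval_zero] at h1
  have hdet : IsUnit (Θ (Q (c 1))).det := by
    have hRb1 : Function.Bijective (R (Q (c 1))) := by rw [hc1]; exact hRb
    have h2 : LinearMap.toMatrix bV bW ((LinearEquiv.ofBijective (R (Q (c 1))) hRb1 : V ≃ₗ[K] W) : V →ₗ[K] W) =
        Θ (Q (c 1)) := rfl
    rw [← h2]
    exact LinearEquiv.isUnit_det _ _ _
  exact hlamfb ((mul_eq_zero.1 h1.symm).resolve_left hdet.ne_zero)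

/-- **The partner `f_b` of EVERY `b ∈ dom f` lies in the Lie subalgebra generated by `𝔞` and the partners of a non-empty
line-open `U ⊆ dom f`.**  (The rational map `f` restricted to the line `c_t = a + t(b - a)`, `a ∈ U`: the polynomial
vector `det((ad c_t)²)·f_{c_t} = adj((ad c_t)²)(-2c_t)` lies in the subalgebra for the infinitely many `t` with `c_t ∈ U`,
hence for `t = 1`.) [cite: LooijengaLunts1997, §1 (1.1) p0004 L31–L37 ("Zariski open … rational map f"), §1 p0007 L66 ("(ii) 𝔤 is … generated by 𝔞 and the image of f")] -/
theorem mem_lieSpan_union_duals_of_lineOpen (hU : U ⊆ lefschetzDomain K h 𝔞) (hne : U.Nonempty)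
    (hline : ∀ a ∈ U, ∀ d ∈ 𝔞, {t : K | a + t • d ∉ U}.Finite) {b fb : L} (hb : b ∈ 𝔞) (tb : IsSl2Triple h b fb) :
    fb ∈ LieSubalgebra.lieSpan K L ((𝔞 : Set L) ∪ {f | ∃ e ∈ U, IsSl2Triple h e f}) := by
  have h1 : fb ∈ (LieSubalgebra.lieSpan K L ((𝔞 : Set L) ∪ {f | ∃ e ∈ U, IsSl2Triple h e f})).toSubmodule :=
    mem_submodule_of_forall_duals_mem_of_lineOpen hU hne hline
      (fun e he f t ↦ LieSubalgebra.subset_lieSpan (Or.inr ⟨e, he, t⟩)) hb tb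
  exact h1

/-- **The image of `f` SPANS the same subspace as `f(U)`** for any non-empty line-open `U ⊆ dom f` (linear span, no
brackets). [cite: LooijengaLunts1997, §1 (1.1) p0004 L31–L37, §3 (3.3) proof p0013 L102–L107] -/
theorem lefschetzDuals_subset_span_duals_of_lineOpen (hU : U ⊆ lefschetzDomain K h 𝔞) (hne : U.Nonempty)
    (hline : ∀ a ∈ U, ∀ d ∈ 𝔞, {t : K | a + t • d ∉ U}.Finite) :
    lefschetzDuals K h 𝔞 ⊆ Submodule.span K {f | ∃ e ∈ U, IsSl2Triple h e f} := by
  rintro fb ⟨b, hb, tb⟩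
  refine mem_submodule_of_forall_duals_mem_of_lineOpen hU hne hline (fun e he f t ↦ ?_) hb tb
  exact Submodule.subset_span (show f ∈ {f | ∃ e ∈ U, IsSl2Triple h e f} from ⟨e, he, t⟩)

/-- … so `span f(U) = span f(dom f)`. [cite: LooijengaLunts1997, §1 (1.1) p0004 L31–L37, §3 (3.3) proof p0013 L102–L107] -/
theorem span_duals_eq_span_lefschetzDuals_of_lineOpen (hU : U ⊆ lefschetzDomain K h 𝔞) (hne : U.Nonempty)
    (hline : ∀ a ∈ U, ∀ d ∈ 𝔞, {t : K | a + t • d ∉ U}.Finite) :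
    Submodule.span K {f | ∃ e ∈ U, IsSl2Triple h e f} = Submodule.span K (lefschetzDuals K h 𝔞) := by
  refine le_antisymm (Submodule.span_mono ?_) (Submodule.span_le.2 (lefschetzDuals_subset_span_duals_of_lineOpen hU hne hline))
  rintro f ⟨e, he, t⟩
  exact (mem_lefschetzDuals_of_isSl2Triple (hU he).1 t).2

/-- **Generic generation.**  For a non-empty `U ⊆ dom f` that is line-open in `𝔞`, the Lie subalgebra generated by `𝔞`
and the partners `{f_a | a ∈ U}` is `𝔤(𝔞, ·)`, the Lie subalgebra generated by `𝔞` and the whole image of `f`.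
[cite: LooijengaLunts1997, §1 (1.1) p0004 L31–L37, §1 p0007 L66] -/
theorem lieSpan_union_duals_eq_lefschetzLieAlgebra_of_lineOpen (hU : U ⊆ lefschetzDomain K h 𝔞) (hne : U.Nonempty)
    (hline : ∀ a ∈ U, ∀ d ∈ 𝔞, {t : K | a + t • d ∉ U}.Finite) :
    LieSubalgebra.lieSpan K L ((𝔞 : Set L) ∪ {f | ∃ e ∈ U, IsSl2Triple h e f}) = lefschetzLieAlgebra K h 𝔞 := by
  refine le_antisymm (LieSubalgebra.lieSpan_mono (Set.union_subset_union_right _ ?_)) ?_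
  · rintro f ⟨e, he, t⟩
    exact (mem_lefschetzDuals_of_isSl2Triple (hU he).1 t).2
  · rw [lefschetzLieAlgebra_le_iff]
    refine ⟨fun x hx ↦ LieSubalgebra.subset_lieSpan (Or.inl hx), ?_⟩
    rintro f ⟨b, hb, tb⟩
    exact mem_lieSpan_union_duals_of_lineOpen hU hne hline hb tb

/-- The image of `f` lies in the subalgebra generated by `𝔞` and `f(U)`. [cite: LooijengaLunts1997, §1 (1.1) p0004 L31–L37] -/
theorem lefschetzDuals_subset_lieSpan_of_lineOpen (hU : U ⊆ lefschetzDomain K h 𝔞) (hne : U.Nonempty)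
    (hline : ∀ a ∈ U, ∀ d ∈ 𝔞, {t : K | a + t • d ∉ U}.Finite) :
    lefschetzDuals K h 𝔞 ⊆ LieSubalgebra.lieSpan K L ((𝔞 : Set L) ∪ {f | ∃ e ∈ U, IsSl2Triple h e f}) := by
  rw [lieSpan_union_duals_eq_lefschetzLieAlgebra_of_lineOpen hU hne hline]
  exact lefschetzDuals_subset_lefschetzLieAlgebra

/-- **For a Lefschetz triple `(𝔤, h, 𝔞)`: `𝔞` and the partners of any non-empty line-open `U ⊆ dom f` generate `𝔤`**
(condition (ii) "`𝔤` is as a Lie algebra generated by `𝔞` and the image of `f`" with the image of `f` replaced by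
`f(U)`). [cite: LooijengaLunts1997, §1 p0007 L66] -/
theorem IsLefschetzTriple.lieSpan_union_duals_eq_top_of_lineOpen (T : IsLefschetzTriple K h 𝔞)
    (hU : U ⊆ lefschetzDomain K h 𝔞) (hne : U.Nonempty) (hline : ∀ a ∈ U, ∀ d ∈ 𝔞, {t : K | a + t • d ∉ U}.Finite) :
    LieSubalgebra.lieSpan K L ((𝔞 : Set L) ∪ {f | ∃ e ∈ U, IsSl2Triple h e f}) = ⊤ := by
  rw [lieSpan_union_duals_eq_lefschetzLieAlgebra_of_lineOpen hU hne hline]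
  exact T.lefschetzLieAlgebra_eq_top

/-- **Images.**  For a morphism `φ : L → L'`, the image of `𝔤(𝔞, ·)` is generated by `φ 𝔞` and the images `φ f_a` of the
partners of a non-empty line-open `U ⊆ dom f` (A1-101 `map_lieSpan`). [cite: LooijengaLunts1997, §1 (1.1) p0004 L31–L37, p0007 L70–L72 ("𝔤(𝔞,M) is just the image of 𝔤")] -/
theorem map_lefschetzLieAlgebra_eq_lieSpan_image_of_lineOpen {L' : Type*} [LieRing L'] [LieAlgebra K L']
    (φ : L →ₗ⁅K⁆ L') (hU : U ⊆ lefschetzDomain K h 𝔞) (hne : U.Nonempty)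
    (hline : ∀ a ∈ U, ∀ d ∈ 𝔞, {t : K | a + t • d ∉ U}.Finite) :
    (lefschetzLieAlgebra K h 𝔞).map φ =
      LieSubalgebra.lieSpan K L' (φ '' (𝔞 : Set L) ∪ φ '' {f | ∃ e ∈ U, IsSl2Triple h e f}) := by
  rw [← lieSpan_union_duals_eq_lefschetzLieAlgebra_of_lineOpen hU hne hline, map_lieSpan, Set.image_union]

end Generic

end Literature.Algebra.Lie
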